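import Literature.MathematicalPhysics.QuantumFieldTheory.Balaban1983to89.B14RegularSpaces234
import Literature.MathematicalPhysics.QuantumFieldTheory.Balaban1983to89.B12RegularSpaces111Gauge

/-!
# `Balaban1983to89.B14RegularSpaces234Gauge` — T. Bałaban, *Convergent renormalization expansions for lattice gauge
theories*, Commun. Math. Phys. **119** (1988) 243–285 [Balaban1988Convergent]: the multi-scale spaces `Ũ^c_j(X, α̃₀, α̃₁)` of p. 261,
(2.34)–(2.39) (sibling `B14RegularSpaces234`) ARE INVARIANT under `G`-valued gauge transformations — the sentence of p. 261, PROVED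
condition by condition with the same constants

HONEST FRAMING (cell `lit-balaban`, verbatim): statement-level skeleton of published theorems with citation tags; proofs where landed; nothing here is a claim about the Yang–Mills mass gap.

PDF held: `paper:balaban1988-cmp119-convergent-renormalization` (journal page = PDF page + 242); read from the page render
`b2b-balaban-ref1/pages/1988-cmp119-convergent-renormalization/…-p019-x2.png` (p. 261), as an image.

WHAT IS REPRODUCED.  The provable member of SKELETON row `B14.Def@261` over the CONCRETE predicates of `B14RegularSpaces234`.  THE PRINT,
verbatim (p. 261, after (2.39)): *«The spaces defined above are invariant with respect to G-valued gauge transformations.»*; and, after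
(2.41): *«(iii) the extended function is invariant with respect to (G-valued) gauge transformations of 𝐔, 𝐉, A (the variables 𝐉, A are
transformed by the adjoint representation of the gauge transformations)»*.

WHAT IS PROVED (theorems only; nothing is defined).  For a `G`-valued gauge transformation `v` (all sites of the `ξ`-lattice) acting by
(I.1.10) `(𝐔, 𝐉)^v = (v₋𝐔v₊⁻¹, R(v₋)𝐉)` (`B12RegularSpaces111.act`), under the STANDING properties of the matrix model made explicit as
hypotheses on `B12RegularSpaces111.Model` exactly as in `B12RegularSpaces111Gauge` — (N) `‖g‖ ≤ 1` on `G` (conjugation by `G` is an isometry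
of `𝔸`, `B12RegularSpaces111Gauge.norm_conj_eq`), (Ad) `𝔤ᶜ` is `Ad(G)`-stable, `G ≤ Gᶜ` — and under the gauge COVARIANCE of the data of (i)
(`U_{p,X}(M˙(𝐔^v)) = U_{p,X}(M˙(𝐔))^w` for some `G`-valued `w` of the lattice of `U_{p,X}`, `|𝐉_{p,X}(M˙(𝐔^v))| = |𝐉_{p,X}(M˙(𝐔))|`; in
print properties of the constructions (2.10)–(2.16) and [15], here hypotheses on the data):
* `condI234_act` — (i): «U ∈ G» and (2.34) for `U ↦ U^v` and `𝐔 ↦ 𝐔^v` (plaquette covariance `B12RegularSpaces111Gauge.plaq_gaugeU` +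
  isometry), (2.35)/(2.37) by the covariance of the data, (2.36) for `𝐉 ↦ R(v)𝐉` (isometry);
* `condII238_gaugeU` — (ii) (2.38): on each cube the local gauge `u ↦ uv⁻¹` with the SAME `A`;
* `condIII239_act` — (iii) (2.39): `A′ ↦ R(v)A′ ∈ 𝔤ᶜ`, `|R(v)A′| = |A′|`, `∇^ξ_{U^v}(R(v)A′) = R(v)∇^ξ_U A′`
  (`B12RegularSpaces111Gauge.nabla_gaugeU_adJ`);
* `satisfies234_act` (the factorisation transforms as `𝐔^v = (exp iξR(v)A′)·U^v`, `B12RegularSpaces111Gauge.factors_act`),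
  `satisfies234_act_iff`, **`act_mem_space234_iff`**: `(𝐔, 𝐉)^v ∈ Ũ^c_j(X, α̃₀, α̃₁) ↔ (𝐔, 𝐉) ∈ Ũ^c_j(X, α̃₀, α̃₁)`.
NOT here: `Gᶜ`-valued transformations (they change the constants; cf. (I.3.29)).  No `Prop` placeholder, no new fact, no definition; axioms
standard.  Unit `lit-balaban-p07` (Phase-2 seat p07 gen 3), HOME `run/shared/lean/pub/lit-balaban/`.
-/

namespace Literature.MathematicalPhysics.QuantumFieldTheory.Balaban1983to89.B14RegularSpaces234Gauge

open Literature.MathematicalPhysics.QuantumFieldTheory.Balaban1983to89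
open Literature.MathematicalPhysics.QuantumFieldTheory.Balaban1983to89.B12RegularSpaces111
open Literature.MathematicalPhysics.QuantumFieldTheory.Balaban1983to89.B12RegularSpaces111Gauge
open Literature.MathematicalPhysics.QuantumFieldTheory.Balaban1983to89.B14Radii
open Literature.MathematicalPhysics.QuantumFieldTheory.Balaban1983to89.B14RegularSpaces234
open Complex

noncomputable section

variable {P : Params} {i : ℕ} {𝔸 : Type*} [NormedRing 𝔸] [NormedAlgebra ℂ 𝔸] [CompleteSpace 𝔸]
variable {𝓜 : Model 𝔸}

/-! ## §1. The conditions (i)–(iii) under `G`-valued gauge transformations -/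

omit [NormedAlgebra ℂ 𝔸] [CompleteSpace 𝔸] in
/-- `|R(v)𝐉(b)| = |𝐉(b)|` for `G`-valued `v` (isometry of the adjoint action). [cite: Balaban1988Convergent, (2.36) p.261] -/
theorem norm_adJ_eq {G : Subgroup 𝔸ˣ} (hG1 : ∀ g ∈ G, ‖(g : 𝔸)‖ ≤ 1) {v : Site P i → 𝔸ˣ} (hv : ∀ x, v x ∈ G)
    (J : PBond P i → 𝔸) (b : PBond P i) : ‖adJ v J b‖ = ‖J b‖ :=
  norm_conj_eq hG1 (hv b.src) (J b)

omit [CompleteSpace 𝔸] in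
/-- **(i) is `G`-invariant**: `(U, (𝐔, 𝐉)) ↦ (U^v, (𝐔, 𝐉)^v)` for `G`-valued `v` preserves «U ∈ G», (2.34) for `U` and for `𝐔`, (2.36), and —
given the gauge covariance of the data `U_{p,X}(M˙(·))`, `𝐉_{p,X}(M˙(·))` at `𝐔` — (2.35), (2.37). [cite: Balaban1988Convergent, (2.34)-(2.37) p.261] -/
theorem condI234_act (hG1 : ∀ g ∈ 𝓜.G, ‖(g : 𝔸)‖ ≤ 1) {F : MSFrame P i 𝔸} {c : MSConsts} {α₀ : ℕ → ℝ}
    {U : PBond P i → 𝔸ˣ} {Φ : FieldPair P i 𝔸ˣ 𝔸} {v : Site P i → 𝔸ˣ} (hv : ∀ x, v x ∈ 𝓜.G)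
    (hUp : ∀ p, ∃ w : Site P (F.bg.lvl p) → 𝔸ˣ, (∀ x, w x ∈ 𝓜.G) ∧ F.bg.Up p (gaugeU v Φ.U) = gaugeU w (F.bg.Up p Φ.U))
    (hJp : ∀ p b, ‖F.bg.Jp p (gaugeU v Φ.U) b‖ = ‖F.bg.Jp p Φ.U b‖) (h : CondI234 𝓜 F c α₀ U Φ) :
    CondI234 𝓜 F c α₀ (gaugeU v U) (act v Φ) := by
  refine ⟨fun b hb => 𝓜.G.mul_mem (𝓜.G.mul_mem (hv _) (h.gValued b hb)) (𝓜.G.inv_mem (hv _)),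
    fun n hn hnj p hp => ?_, fun n hn hnj p hp => ?_, fun p hp hpj n hn hnj q hq => ?_, fun n hn hnj b hb => ?_,
    fun p hp hpj n hn hnj b hb => ?_⟩
  · rw [plaq_gaugeU, Units.val_mul, Units.val_mul, norm_conj_sub_one_eq hG1 (hv p.src)]
    exact h.plaq_lt n hn hnj p hp
  · show ‖(↑(plaq (gaugeU v Φ.U) p) : 𝔸) - 1‖ < _
    rw [plaq_gaugeU, Units.val_mul, Units.val_mul, norm_conj_sub_one_eq hG1 (hv p.src)]
    exact h.plaqU_lt n hn hnj p hp
  · show ‖(↑(plaq (F.bg.Up p (gaugeU v Φ.U)) q) : 𝔸) - 1‖ < _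
    obtain ⟨w, hw, hwp⟩ := hUp p
    rw [hwp, plaq_gaugeU, Units.val_mul, Units.val_mul, norm_conj_sub_one_eq hG1 (hw q.src)]
    exact h.plaqP_lt p hp hpj n hn hnj q hq
  · show ‖adJ v Φ.J b‖ < _
    rw [norm_adJ_eq hG1 hv]
    exact h.J_lt n hn hnj b hb
  · show ‖F.bg.Jp p (gaugeU v Φ.U) b‖ < _
    rw [hJp]
    exact h.JP_lt p hp hpj n hn hnj b hb

/-- **(ii) is `G`-invariant**: `U ↦ U^v` for `G`-valued `v` preserves (2.38) — on each cube the local gauge `u ↦ uv⁻¹` (again `G`-valued)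
and the SAME `A`, since `(U^v)^{uv⁻¹} = U^u`. [cite: Balaban1988Convergent, (2.38) p.261] -/
theorem condII238_gaugeU {F : MSFrame P i 𝔸} {c : MSConsts} {α₀ : ℕ → ℝ} {U : PBond P i → 𝔸ˣ} {v : Site P i → 𝔸ˣ}
    (hv : ∀ x, v x ∈ 𝓜.G) (h : CondII238 𝓜 F c α₀ U) : CondII238 𝓜 F c α₀ (gaugeU v U) := by
  refine ⟨fun n hn hnj C hC => ?_⟩
  obtain ⟨u, hu, A, hgauge, hA, hdA⟩ := h.localGauge n hn hnj C hC
  refine ⟨u * v⁻¹, fun x => 𝓜.G.mul_mem (hu x) (by rw [Pi.inv_apply]; exact 𝓜.G.inv_mem (hv x)), A, ?_, hA, hdA⟩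
  intro b hb
  rw [← gaugeU_mul, inv_mul_cancel_right]
  exact hgauge b hb

omit [CompleteSpace 𝔸] in
/-- **(iii) is `G`-invariant**: `(U, A′) ↦ (U^v, R(v)A′)` for `G`-valued `v` preserves (2.39) (for `Ad(G)`-stable `𝔤ᶜ`): `|R(v)A′| = |A′|` and
`∇^ξ_{U^v}(R(v)A′) = R(v)∇^ξ_U A′`. [cite: Balaban1988Convergent, (2.39) p.261] -/
theorem condIII239_act (hG1 : ∀ g ∈ 𝓜.G, ‖(g : 𝔸)‖ ≤ 1) (hgc : ∀ g ∈ 𝓜.G, ∀ X ∈ 𝓜.gc, (g : 𝔸) * X * ↑g⁻¹ ∈ 𝓜.gc)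
    {F : MSFrame P i 𝔸} {c : MSConsts} {α₁ : ℕ → ℝ} {U : PBond P i → 𝔸ˣ} {A' : PBond P i → 𝔸} {v : Site P i → 𝔸ˣ}
    (hv : ∀ x, v x ∈ 𝓜.G) (h : CondIII239 𝓜 F c α₁ U A') : CondIII239 𝓜 F c α₁ (gaugeU v U) (adJ v A') := by
  refine ⟨fun b hb => hgc _ (hv _) _ (h.gcValued b hb), fun n hn hnj b hb => ?_, fun n hn hnj q hq => ?_⟩
  · rw [norm_adJ_eq hG1 hv]
    exact h.norm_lt n hn hnj b hb
  · rw [nabla_gaugeU_adJ, norm_conj_eq hG1 (hv _)]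
    exact h.nabla_lt n hn hnj q hq

/-! ## §2. «(𝐔, 𝐉) satisfy (i)–(iii)» and the space under `G`-valued gauge transformations -/

/-- **«(𝐔, 𝐉) satisfy (i)–(iii)» is invariant under `G`-valued gauge transformations** (same sequences `α̃₀, α̃₁`): the transformed pair
factorises with `U ↦ U^v`, `A′ ↦ R(v)A′`, and (2.34)–(2.39) are preserved (hypotheses: `‖·‖ ≤ 1` on `G`, `G ≤ Gᶜ`, `𝔤ᶜ` `Ad(G)`-stable,
gauge covariance of the data of (i)). [cite: Balaban1988Convergent, (2.34)-(2.39) p.261] -/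
theorem satisfies234_act (hG1 : ∀ g ∈ 𝓜.G, ‖(g : 𝔸)‖ ≤ 1) (hGc : 𝓜.G ≤ 𝓜.Gc)
    (hgc : ∀ g ∈ 𝓜.G, ∀ X ∈ 𝓜.gc, (g : 𝔸) * X * ↑g⁻¹ ∈ 𝓜.gc) {F : MSFrame P i 𝔸} {c : MSConsts} {α₀ α₁ : ℕ → ℝ}
    {Φ : FieldPair P i 𝔸ˣ 𝔸} {v : Site P i → 𝔸ˣ} (hv : ∀ x, v x ∈ 𝓜.G)
    (hUp : ∀ p (V : PBond P i → 𝔸ˣ), ∃ w : Site P (F.bg.lvl p) → 𝔸ˣ, (∀ x, w x ∈ 𝓜.G) ∧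
      F.bg.Up p (gaugeU v V) = gaugeU w (F.bg.Up p V))
    (hJp : ∀ p (V : PBond P i → 𝔸ˣ) b, ‖F.bg.Jp p (gaugeU v V) b‖ = ‖F.bg.Jp p V b‖)
    (h : Satisfies234 𝓜 F c α₀ α₁ Φ) : Satisfies234 𝓜 F c α₀ α₁ (act v Φ) := by
  obtain ⟨hG, hg, U, A', hf, h1, h2, h3⟩ := h
  refine ⟨fun b hb => ?_, fun b hb => hgc _ (hv _) _ (hg b hb), gaugeU v U, adJ v A', factors_act v hf,
    condI234_act hG1 hv (fun p => hUp p Φ.U) (fun p b => hJp p Φ.U b) h1, condII238_gaugeU hv h2,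
    condIII239_act hG1 hgc hv h3⟩
  exact 𝓜.Gc.mul_mem (𝓜.Gc.mul_mem (hGc (hv _)) (hG b hb)) (𝓜.Gc.inv_mem (hGc (hv _)))

/-- The same as an equivalence (apply the forward direction to `v⁻¹`; the data hypotheses for all `G`-valued `v`).
[cite: Balaban1988Convergent, (2.34)-(2.39) p.261] -/
theorem satisfies234_act_iff (hG1 : ∀ g ∈ 𝓜.G, ‖(g : 𝔸)‖ ≤ 1) (hGc : 𝓜.G ≤ 𝓜.Gc)
    (hgc : ∀ g ∈ 𝓜.G, ∀ X ∈ 𝓜.gc, (g : 𝔸) * X * ↑g⁻¹ ∈ 𝓜.gc) {F : MSFrame P i 𝔸} {c : MSConsts} {α₀ α₁ : ℕ → ℝ}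
    (hUp : ∀ (v : Site P i → 𝔸ˣ), (∀ x, v x ∈ 𝓜.G) → ∀ p (V : PBond P i → 𝔸ˣ), ∃ w : Site P (F.bg.lvl p) → 𝔸ˣ,
      (∀ x, w x ∈ 𝓜.G) ∧ F.bg.Up p (gaugeU v V) = gaugeU w (F.bg.Up p V))
    (hJp : ∀ (v : Site P i → 𝔸ˣ), (∀ x, v x ∈ 𝓜.G) → ∀ p (V : PBond P i → 𝔸ˣ) b,
      ‖F.bg.Jp p (gaugeU v V) b‖ = ‖F.bg.Jp p V b‖)
    (Φ : FieldPair P i 𝔸ˣ 𝔸) {v : Site P i → 𝔸ˣ} (hv : ∀ x, v x ∈ 𝓜.G) :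
    Satisfies234 𝓜 F c α₀ α₁ (act v Φ) ↔ Satisfies234 𝓜 F c α₀ α₁ Φ := by
  refine ⟨fun h => ?_, satisfies234_act hG1 hGc hgc hv (hUp v hv) (hJp v hv)⟩
  have hv' : ∀ x, v⁻¹ x ∈ 𝓜.G := fun x => by
    rw [Pi.inv_apply]
    exact 𝓜.G.inv_mem (hv x)
  simpa only [act_inv_act] using satisfies234_act hG1 hGc hgc hv' (hUp v⁻¹ hv') (hJp v⁻¹ hv') h

/-- **«The spaces defined above are invariant with respect to G-valued gauge transformations»** (p. 261): for a `G`-valued gauge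
transformation `v`, `(𝐔, 𝐉)^v ∈ Ũ^c_j(X, α̃₀, α̃₁) ↔ (𝐔, 𝐉) ∈ Ũ^c_j(X, α̃₀, α̃₁)` (hypotheses: `‖·‖ ≤ 1` on `G`, `G ≤ Gᶜ`, `𝔤ᶜ` `Ad(G)`-stable,
gauge covariance of the data `U_{p,X}(M˙(·))`, `𝐉_{p,X}(M˙(·))` of (i)). [cite: Balaban1988Convergent, (2.39) p.261] -/
theorem act_mem_space234_iff (hG1 : ∀ g ∈ 𝓜.G, ‖(g : 𝔸)‖ ≤ 1) (hGc : 𝓜.G ≤ 𝓜.Gc)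
    (hgc : ∀ g ∈ 𝓜.G, ∀ X ∈ 𝓜.gc, (g : 𝔸) * X * ↑g⁻¹ ∈ 𝓜.gc) {F : MSFrame P i 𝔸} {c : MSConsts} {α₀ α₁ : ℕ → ℝ}
    (hUp : ∀ (v : Site P i → 𝔸ˣ), (∀ x, v x ∈ 𝓜.G) → ∀ p (V : PBond P i → 𝔸ˣ), ∃ w : Site P (F.bg.lvl p) → 𝔸ˣ,
      (∀ x, w x ∈ 𝓜.G) ∧ F.bg.Up p (gaugeU v V) = gaugeU w (F.bg.Up p V))
    (hJp : ∀ (v : Site P i → 𝔸ˣ), (∀ x, v x ∈ 𝓜.G) → ∀ p (V : PBond P i → 𝔸ˣ) b,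
      ‖F.bg.Jp p (gaugeU v V) b‖ = ‖F.bg.Jp p V b‖)
    (Φ : FieldPair P i 𝔸ˣ 𝔸) {v : Site P i → 𝔸ˣ} (hv : ∀ x, v x ∈ 𝓜.G) :
    act v Φ ∈ space234 𝓜 F c α₀ α₁ ↔ Φ ∈ space234 𝓜 F c α₀ α₁ :=
  satisfies234_act_iff hG1 hGc hgc hUp hJp Φ hv

end

end Literature.MathematicalPhysics.QuantumFieldTheory.Balaban1983to89.B14RegularSpaces234Gauge
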